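import Summits.QuantumFields.YangMills.Theorems.FradkinShenkerFlowFiniteSusceptibilityWeakCouplingMirrorDominationAxis0
import Summits.QuantumFields.YangMills.Theorems.FradkinShenkerFlowFiniteSusceptibilityWeakCouplingRPCauchySchwarz
import Summits.QuantumFields.YangMills.Theorems.FradkinShenkerFlowFiniteSusceptibilityWeakCouplingOddTorusRP
import Summits.QuantumFields.YangMills.Theorems.FradkinShenkerFlowFiniteSusceptibilityWeakCouplingSiblingFunnel
import Summits.QuantumFields.YangMills.Theorems.ParabolicTrajectoryTunedSequenceExistsSplitDefs
import Literature.MathematicalPhysics.QuantumLattice.WilsonBlockHeatBathLightCone2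

/-!
# `TunedSequenceExists` (stmt-QuantumFields-10524), line `fixed-aspect-window`:
# the mirror bound — stub (A) `CanonicalUpperBound` reduced to its two RP-DIAGONAL halves

Seat c4 (lead), `--supports stmt-QuantumFields-10524`.  `P := r.curvature.F` is Wilson's CORNER action
density (three magnetic plaquettes in the slice `x⁰ = 0`, three electric ones on the step `0 → 1`); it is
not reflection-symmetric (`Cruxes/…/RPStraddleCounterexample.lean`), so clause (iii) of the crux is not
transfer-matrix glue for `P` and the line carries the a-priori bound as the explicit stub
(A) `CanonicalUpperBound r : ∃ β₁ K, ∀ β ≥ β₁, ∀ L D, D ≤ L → D⁸ |⟨P ; τ_D P⟩_{β,2L+1}| ≤ K`.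

Let `Pᴿ := P ∘ Θ` be the MIRROR corner density (`Θ = cfgReflect`, the site time reflection of `ℤ⁴`:
electric plaquettes read one step DOWN, `ActionDensityTimeReflection`).  Proved here, for every compact
`G`, every lattice representation `r`, every `β ≥ 0`, on every odd torus `2S+1`:

* `sq_cov_le_mirror` — for `4 ≤ n ≤ S`, `p = ⌊n/2⌋`:
  `⟨P ; τ_n P⟩² ≤ ⟨P ; τ_{2p+1} Pᴿ⟩ · ⟨Pᴿ ; τ_{2n-2p-1} P⟩` with both factors `≥ 0`
  (odd-torus reflection positivity through the link hyperplane `t = p + ½` + Cauchy–Schwarz: the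
  replay, for `A = B = r.curvature`, of the sibling crux's landed `stub_mirrorDominationAxis0`, keeping the
  two diagonal terms explicit instead of `∃`-packaged);
* `sq_corr_le_mirror_odd / _even / _even_top` — the same in the crux's `latticeConnectedCorr` format:
  lags `(n, n)` for odd `n`, `(n+1, n-1)` for even `n < S`, and `(S, S-1)` (folded) for even `n = S`;
* `canonicalUpperBound_of_mirror` — **(A) follows from the canonical upper bounds for the two mirror
  correlators** `D⁸ ⟨P ; τ_D Pᴿ⟩ ≤ K_in`, `D⁸ ⟨Pᴿ ; τ_D P⟩ ≤ K_out` (`D ≤ L`, `β ≥ β₁`), with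
  `K = max (4⁸ · 2C_P²) (max K_in (2⁸ K_out))`; `canonicalUpperBoundAll_of_mirror` — the same under the
  crux's quantifier prefix (the reshaped skeleton's stubs `stub_mirrorBoundIn`, `stub_mirrorBoundOut`).

Why this is the right cut: each mirror correlator is RP-DIAGONAL (`= Cov(F∘Θ, F) ≥ 0`), i.e. a
positive spectral measure of the transfer operator — the canonical upper bound for it is a statement about
the low-energy spectral weight of ONE vector, with no sign cancellations.  The hard content (UV stability
with one curvature insertion carried through the crossover) is unchanged; only the bookkeeping of the
straddling observable is discharged.  References: Osterwalder–Seiler 1978 §2 (reflection, positivity);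
Seiler LNP 159 Ch. 2.
-/

noncomputable section

open MeasureTheory ProbabilityTheory Finset
open Literature.MathematicalPhysics.QuantumFieldTheory hiding Site ZdEdge
open Literature.MathematicalPhysics.QuantumLattice
open Literature.Probability.LatticeModels hiding configShift configShift_apply
open Summit.QuantumFields.YangMills.Theorems.FiniteSusceptibilityWeakCoupling
open Summit.QuantumFields.YangMills.Theorems.FiniteSusceptibilityWeakCoupling.MirrorDominationAxis0

namespace Summit.QuantumFields.YangMills.Theorems.TunedSequenceExists.MirrorBound

variable {G : Type} [Group G] [TopologicalSpace G] [IsTopologicalGroup G] [CompactSpace G]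
  [MeasurableSpace G] [BorelSpace G]

/-! ## The support of the corner density has time radius one -/

/-- Every link read by the corner action density has base point in the slices `x⁰ ∈ {0, 1}`. [folklore] -/
theorem natAbs_le_one_of_mem_curvature_supp (r : LatticeRep G) {e : ZdEdge 4}
    (he : e ∈ r.curvature.supp) : (e.1 0).natAbs ≤ 1 := by
  simp only [LatticeRep.curvature, Finset.mem_biUnion, Finset.mem_univ, true_and] at he
  obtain ⟨⟨i, j⟩, he⟩ := he
  simp only [originPlaquetteSupport, Finset.mem_insert, Finset.mem_singleton] at he
  rcases he with rfl | rfl | rfl | rfl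
  · simp
  · simp only [Pi.single_apply]
    split_ifs <;> simp
  · simp only [Pi.single_apply]
    split_ifs <;> simp
  · simp

/-! ## The mirror bound in covariance form (odd-torus RP + Cauchy–Schwarz through `t = ⌊n/2⌋ + ½`) -/

/-- **The mirror bound (covariance form).** For `β ≥ 0`, `4 ≤ n ≤ S` and `p = ⌊n/2⌋`, on the odd torus
`2S+1`: `Cov(P, τ_n P)² ≤ Cov(P, τ_{2p+1} Pᴿ) · Cov(Pᴿ, τ_{2n-2p-1} P)` and both factors are `≥ 0`
(`P = r.curvature.F` lifted, `Pᴿ = (reflSpecies r.curvature).F`, `τ_j = configShift (-j e₀)`).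
Reflection positivity through the link hyperplane `t = p + ½` (`stub_oddTorusRP`, `stub_rpCauchySchwarz`
of the sibling crux, landed) applied to `F = Pᴿ ∘ τ_{2p+1} ∘ lift`, `G' = P ∘ τ_n ∘ lift`.
[cite: OsterwalderSeiler1978, §2] -/
theorem sq_cov_le_mirror (r : LatticeRep G) {β : ℝ} (hβ : 0 ≤ β) {S n : ℕ} (h4 : 4 ≤ n)
    (hn : n ≤ S) :
    0 ≤ cov[fun U => r.curvature.F (torusLift (2 * S + 1) U),
        fun U => (reflSpecies r.curvature).F
          (configShift (-(Pi.single 0 ((2 * (n / 2) + 1 : ℕ) : ℤ))) (torusLift (2 * S + 1) U));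
        wilsonMeasure (d := 4) (L := 2 * S + 1) r.ρ β] ∧
    0 ≤ cov[fun U => (reflSpecies r.curvature).F (torusLift (2 * S + 1) U),
        fun U => r.curvature.F
          (configShift (-(Pi.single 0 ((2 * n - 2 * (n / 2) - 1 : ℕ) : ℤ))) (torusLift (2 * S + 1) U));
        wilsonMeasure (d := 4) (L := 2 * S + 1) r.ρ β] ∧
    cov[fun U => r.curvature.F (torusLift (2 * S + 1) U),
        fun U => r.curvature.F (configShift (-(Pi.single 0 (n : ℤ))) (torusLift (2 * S + 1) U));
        wilsonMeasure (d := 4) (L := 2 * S + 1) r.ρ β] ^ 2 ≤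
      cov[fun U => r.curvature.F (torusLift (2 * S + 1) U),
          fun U => (reflSpecies r.curvature).F
            (configShift (-(Pi.single 0 ((2 * (n / 2) + 1 : ℕ) : ℤ))) (torusLift (2 * S + 1) U));
          wilsonMeasure (d := 4) (L := 2 * S + 1) r.ρ β] *
        cov[fun U => (reflSpecies r.curvature).F (torusLift (2 * S + 1) U),
          fun U => r.curvature.F
            (configShift (-(Pi.single 0 ((2 * n - 2 * (n / 2) - 1 : ℕ) : ℤ)))
              (torusLift (2 * S + 1) U));
          wilsonMeasure (d := 4) (L := 2 * S + 1) r.ρ β] := by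
  -- adapted from `…FiniteSusceptibilityWeakCoupling.stub_mirrorDominationAxis0` (A = B = r.curvature,
  -- x = n e₀), keeping the diagonal terms explicit
  set A : YMSpecies G := r.curvature with hA
  set p : ℕ := n / 2 with hp
  set x : Site 4 := Pi.single 0 (n : ℤ) with hx
  have hx0 : x 0 = n := by simp [hx]
  have hRA : ∀ e ∈ A.supp, (e.1 0).natAbs ≤ 1 := fun e he =>
    natAbs_le_one_of_mem_curvature_supp r he
  haveI : IsProbabilityMeasure (wilsonMeasure (d := 4) (L := 2 * S + 1) r.ρ β) :=
    isProbabilityMeasure_wilsonMeasure _ r.continuous β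
  have hCS := stub_rpCauchySchwarz stub_oddTorusRP
  -- RP + Cauchy–Schwarz in the plane `(1, p e₀)` for `F = Aᴿ∘τ_{-(2p+1)e₀}∘lift`, `G' = A∘τ_{-x}∘lift`
  obtain ⟨hD₁, hD₂, hcs⟩ := hCS G r.N r.ρ r.continuous β hβ S (by omega) 1
    (Torus.proj (2 * S + 1) (Pi.single 0 (p : ℤ)))
    (fun U => (reflSpecies A).F
      (configShift (-(Pi.single 0 ((2 * p + 1 : ℕ) : ℤ))) (torusLift (2 * S + 1) U)))
    (fun U => A.F (configShift (-x) (torusLift (2 * S + 1) U)))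
    ((reflSpecies A).measurable.comp ((configShift _).measurable.comp (measurable_torusLift _)))
    (A.measurable.comp ((configShift _).measurable.comp (measurable_torusLift _)))
    (by obtain ⟨C, hC⟩ := (reflSpecies A).bounded; exact ⟨C, fun U => hC _⟩)
    (by obtain ⟨C, hC⟩ := A.bounded; exact ⟨C, fun U => hC _⟩)
    (by
      refine (Negative.dependsOn_comp_configShift_torusLift (2 * S + 1) (reflSpecies A) _).mono ?_
      intro e he
      obtain ⟨e', he', rfl⟩ := Finset.mem_image.1 (Finset.mem_coe.1 he)
      obtain ⟨e'', he'', rfl⟩ := Finset.mem_image.1 he'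
      have ht := hRA e'' he''
      have h0 : ((reflectEdge e'').1 + (Pi.single 0 ((2 * p + 1 : ℕ) : ℤ) : Site 4)) 0 =
          (if e''.2 = 0 then -e''.1 0 - 1 else -e''.1 0) + (2 * p + 1 : ℕ) := by
        rw [Pi.add_apply, reflectEdge_fst_zero, Pi.single_eq_same]
      refine torusEdge_mem_pos S p _ _ ?_ ?_ <;> rw [h0] <;> split_ifs <;> omega)
    (by
      refine (Negative.dependsOn_comp_configShift_torusLift (2 * S + 1) A x).mono ?_
      intro e he
      obtain ⟨e', he', rfl⟩ := Finset.mem_image.1 (Finset.mem_coe.1 he)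
      have ht := hRA e' he'
      have h0 : (e'.1 + x) 0 = e'.1 0 + n := by rw [Pi.add_apply, hx0]
      refine torusEdge_mem_pos S p _ _ ?_ ?_ <;> rw [h0] <;> omega)
  -- `F∘Θ = A∘lift`, `G'∘Θ = Aᴿ∘τ_{-(θx+(2p+1)e₀)}∘lift`
  simp only [torusLift_theta, reflSpecies_F_shift_cfgReflect_shift] at hD₁ hD₂ hcs
  simp only [F_shift_cfgReflect_shift] at hD₂ hcs
  have hvec : -x + (siteReflect x + Pi.single 0 ((2 * p + 1 : ℕ) : ℤ)) =
      -(Pi.single 0 ((2 * n - 2 * p - 1 : ℕ) : ℤ)) := by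
    funext k; by_cases hk : k = 0 <;> simp [siteReflect_apply, hk, hx]
    omega
  rw [cov_translate_left r.ρ β (reflSpecies A).F A.F hvec] at hD₂ hcs
  exact ⟨hD₁, hD₂, hcs⟩

/-! ## The mirror bound in the crux's `latticeConnectedCorr` format -/

/-- The mirror corner density `Pᴿ = P ∘ Θ` as a function (the `F` of `reflSpecies r.curvature`). -/
theorem reflSpecies_curvature_F (r : LatticeRep G) :
    (reflSpecies r.curvature).F = fun V => r.curvature.F (cfgReflect V) := rfl

/-- **Mirror bound, odd separation.** For `β ≥ 0` and odd `n` with `4 ≤ n ≤ S`: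
`⟨P ; τ_n P⟩² ≤ ⟨P ; τ_n Pᴿ⟩ · ⟨Pᴿ ; τ_n P⟩` on the torus `2S+1`, both factors `≥ 0`.
[cite: OsterwalderSeiler1978, §2] -/
theorem sq_corr_le_mirror_odd (r : LatticeRep G) {β : ℝ} (hβ : 0 ≤ β) {S n : ℕ} (h4 : 4 ≤ n)
    (hn : n ≤ S) (hodd : Odd n) :
    0 ≤ latticeConnectedCorr r.ρ β (2 * S + 1) r.curvature.F
        (fun V => r.curvature.F (cfgReflect V)) n ∧
    0 ≤ latticeConnectedCorr r.ρ β (2 * S + 1) (fun V => r.curvature.F (cfgReflect V))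
        r.curvature.F n ∧
    latticeConnectedCorr r.ρ β (2 * S + 1) r.curvature.F r.curvature.F n ^ 2 ≤
      latticeConnectedCorr r.ρ β (2 * S + 1) r.curvature.F
          (fun V => r.curvature.F (cfgReflect V)) n *
        latticeConnectedCorr r.ρ β (2 * S + 1) (fun V => r.curvature.F (cfgReflect V))
          r.curvature.F n := by
  obtain ⟨h₁, h₂, h₃⟩ := sq_cov_le_mirror r hβ h4 hn
  obtain ⟨p, rfl⟩ := hodd
  have hp : (2 * p + 1) / 2 = p := by omega
  have hq : 2 * (2 * p + 1) - 2 * p - 1 = 2 * p + 1 := by omega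
  rw [hp, hq] at h₂ h₃
  rw [hp] at h₁
  rw [SiblingFunnel.covariance_eq_latticeConnectedCorr, SiblingFunnel.covariance_eq_latticeConnectedCorr,
    SiblingFunnel.covariance_eq_latticeConnectedCorr] at h₃
  rw [SiblingFunnel.covariance_eq_latticeConnectedCorr] at h₁ h₂
  exact ⟨h₁, h₂, h₃⟩

/-- **Mirror bound, even separation below the top.** For `β ≥ 0` and even `n` with `4 ≤ n < S`:
`⟨P ; τ_n P⟩² ≤ ⟨P ; τ_{n+1} Pᴿ⟩ · ⟨Pᴿ ; τ_{n-1} P⟩` on the torus `2S+1`, both factors `≥ 0`.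
[cite: OsterwalderSeiler1978, §2] -/
theorem sq_corr_le_mirror_even (r : LatticeRep G) {β : ℝ} (hβ : 0 ≤ β) {S n : ℕ} (h4 : 4 ≤ n)
    (hn : n < S) (heven : Even n) :
    0 ≤ latticeConnectedCorr r.ρ β (2 * S + 1) r.curvature.F
        (fun V => r.curvature.F (cfgReflect V)) (n + 1) ∧
    0 ≤ latticeConnectedCorr r.ρ β (2 * S + 1) (fun V => r.curvature.F (cfgReflect V))
        r.curvature.F (n - 1) ∧
    latticeConnectedCorr r.ρ β (2 * S + 1) r.curvature.F r.curvature.F n ^ 2 ≤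
      latticeConnectedCorr r.ρ β (2 * S + 1) r.curvature.F
          (fun V => r.curvature.F (cfgReflect V)) (n + 1) *
        latticeConnectedCorr r.ρ β (2 * S + 1) (fun V => r.curvature.F (cfgReflect V))
          r.curvature.F (n - 1) := by
  obtain ⟨h₁, h₂, h₃⟩ := sq_cov_le_mirror r hβ h4 hn.le
  obtain ⟨p, rfl⟩ := heven
  have hp : (p + p) / 2 = p := by omega
  have hq : 2 * (p + p) - 2 * p - 1 = p + p - 1 := by omega
  have hq' : 2 * p + 1 = p + p + 1 := by omega
  rw [hp] at h₁ h₂ h₃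
  rw [hq'] at h₁
  rw [hq] at h₂
  rw [hq', hq] at h₃
  rw [SiblingFunnel.covariance_eq_latticeConnectedCorr, SiblingFunnel.covariance_eq_latticeConnectedCorr,
    SiblingFunnel.covariance_eq_latticeConnectedCorr] at h₃
  rw [SiblingFunnel.covariance_eq_latticeConnectedCorr] at h₁ h₂
  exact ⟨h₁, h₂, h₃⟩

/-- **Mirror bound, even separation at the top (folded).** For `β ≥ 0` and even `S ≥ 4`, at the maximal
separation `n = S` of the torus `2S+1` the lag `S+1` is folded back by periodicity:
`⟨P ; τ_S P⟩² ≤ ⟨Pᴿ ; τ_S P⟩ · ⟨Pᴿ ; τ_{S-1} P⟩`, both factors `≥ 0`. [cite: OsterwalderSeiler1978, §2] -/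
theorem sq_corr_le_mirror_even_top (r : LatticeRep G) {β : ℝ} (hβ : 0 ≤ β) {S : ℕ} (h4 : 4 ≤ S)
    (heven : Even S) :
    0 ≤ latticeConnectedCorr r.ρ β (2 * S + 1) (fun V => r.curvature.F (cfgReflect V))
        r.curvature.F S ∧
    0 ≤ latticeConnectedCorr r.ρ β (2 * S + 1) (fun V => r.curvature.F (cfgReflect V))
        r.curvature.F (S - 1) ∧
    latticeConnectedCorr r.ρ β (2 * S + 1) r.curvature.F r.curvature.F S ^ 2 ≤
      latticeConnectedCorr r.ρ β (2 * S + 1) (fun V => r.curvature.F (cfgReflect V))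
          r.curvature.F S *
        latticeConnectedCorr r.ρ β (2 * S + 1) (fun V => r.curvature.F (cfgReflect V))
          r.curvature.F (S - 1) := by
  obtain ⟨h₁, h₂, h₃⟩ := sq_cov_le_mirror r hβ h4 le_rfl
  obtain ⟨p, rfl⟩ := heven
  have hp : (p + p) / 2 = p := by omega
  have hq : 2 * (p + p) - 2 * p - 1 = p + p - 1 := by omega
  rw [hp] at h₁ h₂ h₃
  rw [hq] at h₂ h₃
  -- fold the lag `2p + 1 = S + 1` to `S` (periodicity + translation invariance + symmetry)
  rw [cov_fold r.ρ β r.curvature.F (reflSpecies r.curvature).F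
    (show 2 * p + 1 ≤ 2 * (p + p) + 1 by omega)] at h₁ h₃
  have hS : 2 * (p + p) + 1 - (2 * p + 1) = p + p := by omega
  rw [hS] at h₁ h₃
  rw [SiblingFunnel.covariance_eq_latticeConnectedCorr, SiblingFunnel.covariance_eq_latticeConnectedCorr,
    SiblingFunnel.covariance_eq_latticeConnectedCorr] at h₃
  rw [SiblingFunnel.covariance_eq_latticeConnectedCorr] at h₁ h₂
  exact ⟨h₁, h₂, h₃⟩

/-! ## (A) from the two mirror bounds -/

/-- The elementary step: `c² ≤ X Y`, `0 ≤ X, Y`, `D⁸ X ≤ M`, `D⁸ Y ≤ M` give `D⁸ |c| ≤ M`. [folklore] -/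
theorem pow_mul_abs_le {c X Y M t : ℝ} (ht : 0 ≤ t) (h : c ^ 2 ≤ X * Y) (hX : 0 ≤ X) (hY : 0 ≤ Y)
    (hXM : t * X ≤ M) (hYM : t * Y ≤ M) : t * |c| ≤ M := by
  have h' : (t * c) ^ 2 ≤ (t * X) * (t * Y) := by
    rw [mul_pow]
    calc t ^ 2 * c ^ 2 ≤ t ^ 2 * (X * Y) := mul_le_mul_of_nonneg_left h (by positivity)
      _ = t * X * (t * Y) := by ring
  have := abs_le_of_sq_le_mul h' (by positivity) (by positivity) hXM hYM
  rwa [abs_mul, abs_of_nonneg ht] at this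

/-- **(A) from the mirror bounds.** If the two mirror correlators of the corner density obey canonical
upper bounds at weak coupling — `D⁸ |⟨P ; τ_D Pᴿ⟩_{β,2L+1}| ≤ K_in` and `D⁸ |⟨Pᴿ ; τ_D P⟩_{β,2L+1}| ≤ K_out`
for `β ≥ β₁`, all `L`, all `D ≤ L` — then so does the corner correlator itself:
`CanonicalUpperBound r` (stub (A) of the line `fixed-aspect-window`).  Separations `D ≤ 3` by the
trivial bound `2 C_P²`; `4 ≤ D ≤ L` by the mirror bound (lags within one of `D`, the lag `D - 1 ≥ D/2`
costing the factor `2⁸`). [cite: OsterwalderSeiler1978, §2] -/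
theorem canonicalUpperBound_of_mirror (r : LatticeRep G)
    (hin : ∃ (β₁ K : ℝ), ∀ β : ℝ, β₁ ≤ β → ∀ (L D : ℕ), D ≤ L →
      (D : ℝ) ^ 8 * |latticeConnectedCorr r.ρ β (2 * L + 1) r.curvature.F
        (fun V => r.curvature.F (cfgReflect V)) D| ≤ K)
    (hout : ∃ (β₁ K : ℝ), ∀ β : ℝ, β₁ ≤ β → ∀ (L D : ℕ), D ≤ L →
      (D : ℝ) ^ 8 * |latticeConnectedCorr r.ρ β (2 * L + 1)
        (fun V => r.curvature.F (cfgReflect V)) r.curvature.F D| ≤ K) :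
    FixedAspectSplit.CanonicalUpperBound r := by
  obtain ⟨β₁, K₁, h₁⟩ := hin
  obtain ⟨β₂, K₂, h₂⟩ := hout
  obtain ⟨C, hC⟩ := r.curvature.bounded
  -- `K₂ ≥ 0` (instance `D = 0`)
  have hK₂ : 0 ≤ K₂ := by simpa using h₂ β₂ le_rfl 0 0 le_rfl
  set M : ℝ := max K₁ (2 ^ 8 * K₂) with hM
  have hK₂M : K₂ ≤ M := le_max_of_le_right (by nlinarith)
  refine ⟨max (max β₁ β₂) 0, max ((4 : ℝ) ^ 8 * (2 * (C * C))) M, fun β hβ L D hDL => ?_⟩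
  have hβ₁ : β₁ ≤ β := ((le_max_left _ _).trans (le_max_left _ _)).trans hβ
  have hβ₂ : β₂ ≤ β := ((le_max_right _ _).trans (le_max_left _ _)).trans hβ
  have hβ0 : 0 ≤ β := (le_max_right _ _).trans hβ
  rcases lt_or_ge D 4 with hD4 | hD4
  · -- short separations: trivial bound
    refine le_trans ?_ (le_max_left _ _)
    have hcorr := WilsonBlockHeatBath.abs_latticeConnectedCorr_le_two_mul r β (2 * L + 1) (A := r.curvature.F)
      (B := r.curvature.F) hC hC D
    have hD : (D : ℝ) ^ 8 ≤ (4 : ℝ) ^ 8 := by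
      gcongr
      exact_mod_cast hD4.le
    have hCC : 0 ≤ 2 * (C * C) := by nlinarith
    exact mul_le_mul hD hcorr (abs_nonneg _) (by positivity)
  · -- `4 ≤ D ≤ L`: the mirror bound
    refine le_trans ?_ (le_max_right _ _)
    have hDpos : (0 : ℝ) ≤ (D : ℝ) ^ 8 := by positivity
    -- the generic estimate for a non-negative mirror correlator at a lag `j` with `D ≤ 2 j`, `j ≤ L`
    have hlagIn : ∀ j : ℕ, D ≤ j → j ≤ L →
        0 ≤ latticeConnectedCorr r.ρ β (2 * L + 1) r.curvature.F
          (fun V => r.curvature.F (cfgReflect V)) j →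
        (D : ℝ) ^ 8 * latticeConnectedCorr r.ρ β (2 * L + 1) r.curvature.F
          (fun V => r.curvature.F (cfgReflect V)) j ≤ M := by
      intro j hDj hjL hpos
      have hb := h₁ β hβ₁ L j hjL
      rw [abs_of_nonneg hpos] at hb
      have hDj' : (D : ℝ) ^ 8 ≤ (j : ℝ) ^ 8 := pow_le_pow_left₀ (by positivity) (by exact_mod_cast hDj) 8
      exact ((mul_le_mul_of_nonneg_right hDj' hpos).trans hb).trans (le_max_left _ _)
    have hlagOut : ∀ j : ℕ, D ≤ 2 * j → j ≤ L →
        0 ≤ latticeConnectedCorr r.ρ β (2 * L + 1) (fun V => r.curvature.F (cfgReflect V))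
          r.curvature.F j →
        (D : ℝ) ^ 8 * latticeConnectedCorr r.ρ β (2 * L + 1) (fun V => r.curvature.F (cfgReflect V))
          r.curvature.F j ≤ M := by
      intro j hDj hjL hpos
      have hb := h₂ β hβ₂ L j hjL
      rw [abs_of_nonneg hpos] at hb
      have hDj' : (D : ℝ) ^ 8 ≤ 2 ^ 8 * (j : ℝ) ^ 8 := by
        rw [← mul_pow]
        exact pow_le_pow_left₀ (by positivity) (by exact_mod_cast hDj) 8
      calc (D : ℝ) ^ 8 * latticeConnectedCorr r.ρ β (2 * L + 1)
              (fun V => r.curvature.F (cfgReflect V)) r.curvature.F j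
          ≤ 2 ^ 8 * (j : ℝ) ^ 8 * latticeConnectedCorr r.ρ β (2 * L + 1)
              (fun V => r.curvature.F (cfgReflect V)) r.curvature.F j :=
            mul_le_mul_of_nonneg_right hDj' hpos
        _ = 2 ^ 8 * ((j : ℝ) ^ 8 * latticeConnectedCorr r.ρ β (2 * L + 1)
              (fun V => r.curvature.F (cfgReflect V)) r.curvature.F j) := by ring
        _ ≤ 2 ^ 8 * K₂ := mul_le_mul_of_nonneg_left hb (by positivity)
        _ ≤ M := le_max_right _ _
    rcases Nat.even_or_odd D with hev | hodd
    · rcases hDL.lt_or_eq with hlt | heq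
      · obtain ⟨hX, hY, hsq⟩ := sq_corr_le_mirror_even r hβ0 hD4 hlt hev
        exact pow_mul_abs_le hDpos hsq hX hY (hlagIn (D + 1) (by omega) (by omega) hX)
          (hlagOut (D - 1) (by omega) (by omega) hY)
      · subst heq
        obtain ⟨hX, hY, hsq⟩ := sq_corr_le_mirror_even_top r hβ0 hD4 hev
        exact pow_mul_abs_le hDpos hsq hX hY (hlagOut D (by omega) le_rfl hX)
          (hlagOut (D - 1) (by omega) (by omega) hY)
    · obtain ⟨hX, hY, hsq⟩ := sq_corr_le_mirror_odd r hβ0 hD4 hDL hodd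
      exact pow_mul_abs_le hDpos hsq hX hY (hlagIn D le_rfl hDL hX)
        (hlagOut D (by omega) hDL hY)

/-- **(A) under the crux's prefix from the two mirror bounds under the crux's prefix** — the glue of the
reshaped skeleton: stubs `stub_mirrorBoundIn`, `stub_mirrorBoundOut` ⇒ `CanonicalUpperBoundAll`.
[cite: OsterwalderSeiler1978, §2] -/
theorem canonicalUpperBoundAll_of_mirror
    (hin : ∀ (G : Type) [Group G] [TopologicalSpace G] [IsTopologicalGroup G] [CompactSpace G],
      IsCompactSimpleLieGroup G → letI : MeasurableSpace G := borel G
      haveI : BorelSpace G := ⟨rfl⟩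
      ∀ (r : LatticeRep G),
      ∃ (β₁ K : ℝ), ∀ β : ℝ, β₁ ≤ β → ∀ (L D : ℕ), D ≤ L →
        (D : ℝ) ^ 8 * |latticeConnectedCorr r.ρ β (2 * L + 1) r.curvature.F
          (fun V => r.curvature.F (cfgReflect V)) D| ≤ K)
    (hout : ∀ (G : Type) [Group G] [TopologicalSpace G] [IsTopologicalGroup G] [CompactSpace G],
      IsCompactSimpleLieGroup G → letI : MeasurableSpace G := borel G
      haveI : BorelSpace G := ⟨rfl⟩
      ∀ (r : LatticeRep G),
      ∃ (β₁ K : ℝ), ∀ β : ℝ, β₁ ≤ β → ∀ (L D : ℕ), D ≤ L →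
        (D : ℝ) ^ 8 * |latticeConnectedCorr r.ρ β (2 * L + 1)
          (fun V => r.curvature.F (cfgReflect V)) r.curvature.F D| ≤ K) :
    FixedAspectSplit.CanonicalUpperBoundAll := by
  intro G _ _ _ _ hG
  letI : MeasurableSpace G := borel G
  haveI : BorelSpace G := ⟨rfl⟩
  intro r
  exact canonicalUpperBound_of_mirror r (hin G hG r) (hout G hG r)

end Summit.QuantumFields.YangMills.Theorems.TunedSequenceExists.MirrorBound

end
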